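import Summits.BirchSwinnertonDyer.BirchSwinnertonDyer.Theorems.EisensteinPrimesSurLambdaCaseCTCOfPoitouTateAt
import Summits.BirchSwinnertonDyer.BirchSwinnertonDyer.Theorems.EisensteinPrimesPoitouTateShaNaturalAtTC
import Summits.BirchSwinnertonDyer.BirchSwinnertonDyer.Theorems.EisensteinPrimesAcTwistDeformationImprimCorankOfSurC
import Summits.BirchSwinnertonDyer.BirchSwinnertonDyer.Theorems.EisensteinPrimesGoodLatticeCorankOfGe
import Summits.BirchSwinnertonDyer.BirchSwinnertonDyer.Theorems.EisensteinPrimesGoodLatticeQuotientOfCorank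
import Summits.BirchSwinnertonDyer.BirchSwinnertonDyer.Theorems.EisensteinPrimesGoodLatticeImprimitiveOfQuotient
import Literature.NumberTheory.IwasawaTheory.Greenberg2006.GlobalEulerPoincareCorankOfTateTC
import Literature.NumberTheory.GaloisCohomology.TateGlobalEulerCharacteristicTotallyComplex
import Literature.NumberTheory.GaloisCohomology.RestrictedRamificationPoitouTateThreeLeTotallyComplex
import Literature.NumberTheory.GaloisRepresentations.LocalEulerPoincareCharacteristicProofs
import Literature.NumberTheory.IwasawaTheory.Greenberg2006.LocalH2VanishingOfLOC1
import HarnessLib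

/-!
# Keller–Yin 2402.12781 Prop. 1.2.5 for the residual pair ([PWL-θ]) — the four Literature named facts
# `KellerYin2024.prop125_residualPair_unrSelmer_{corank_ge, corank, quotient, imprimitive}` — DISCHARGED in the kernel (no hypothesis):
# cell `bsd-eis`'s roads (A) «AcTwistDeformation … OfSurC», «CorankOfGe», «QuotientOfCorank», «ImprimitiveOfQuotient» fed with the tree theorems
# Greenberg 2016 Prop. 2.6.3 (c) at totally complex `K` (this seat's F43 `SurLambda.prop263_sur_of_crk_caseC_tc_holds`), Greenberg 2006 Props. 4.1 /
# 4.2 / §5 A and Tate's global Euler–Poincaré characteristic at totally complex fields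

Cell `bsd-schneider-ideate`, seat `bsd-schneider-door-c5` (prover, generation 41; `--supports` stmt-BirchSwinnertonDyer-19177, the K1 door's crux r3
`GordTwoBranchIMC`, whose `p = 3` anomalous column and whose by-name form consume [PWL-θ] = `prop125_residualPair_unrSelmer_imprimitive` — generation 40's
F40a–F42, this generation's F44/F45).  PARTITION: board row B6 ∩ X3 ∩ sst-twist, `r = 1` of `Rank1Residual.partition` — INPUT LAYER (one named input of the door
and of cell `bsd-eis`'s halves / cell-C chains becomes a tree theorem); types-the-object-of nothing new; closes none of B6's cells; «closes rung: none» (BSD NOT advanced).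

WHAT.  `Literature/NumberTheory/EllipticCurves/KellerYin2024/AnomalousImprimitiveLambdaInvariants.lean` types Keller–Yin's Prop. 1.2.5 (= CGLS 2022 Prop. 1.2.5 read
for the residual pair `θ ∈ {θsub, θquot}` of `E[p]` over an imaginary quadratic `K` with (Heeg), `p > 2` good anomalous reducible, `κ` anticyclotomic, `Sf` the places
over `N_E`) in four strengths, each GIVEN [RH] for the primitive dual (a binder inside the statement): `…_corank_ge` (the `≥` half of the `S`-relaxation corank identity
`corank_{ℤ_p}(H¹_{𝓕_nr^{Sf}}/H¹_{𝓕_nr}) ≥ Σ_{w∈Sf} λ𝒫_w(θ)` — Pollack–Weston A.2 surjectivity), `…_corank` (the identity), `…_quotient` (the identity ∧ `(quotient)[p]`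
finite), `…_imprimitive` (every imprimitive dual datum f.g. `Λ`-torsion with `μ = 0` ∧ the identity = [PWL-θ] as the K1 door and the Eisenstein chains read it).
Cell `bsd-eis` proved, in the kernel: `≥` ⟸ Greenberg 2016 Prop. 2.6.3 (c) at totally complex `K` + Greenberg 2006 Props. 4.1, 4.2, §5 A + Tate's EPC at TC fields
(`AcTwistDeformation.prop125_residualPair_unrSelmer_corank_ge_of_facts_ofSurC`: the one-variable anticyclotomic twist deformation `ℚ_p/ℤ_p(θ) ⊗ Λ^*(κ⁻¹)` — cofree,
LEO by the corank squeeze, LOC⁽¹⁾, CRK — Shapiro in both directions, Brink's finite decomposition, the per-place tame count); identity ⟸ `≥`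
(`GoodLatticeCorankOfGe.prop125_corank_of_ge`: the `≤` half is the kernel embedding of the quotient into `∏_{w∈Sf} ∏_{η∣w} H¹(I_η, (F/𝒪)(θ))`); quotient ⟸ identity
(`GoodLatticeQuotientOfCorank.prop125_quotient_of_corank`: Kummer + Milne I.2.9); imprimitive ⟸ quotient (`GoodLatticeImprimitiveOfQuotient.prop125_imprimitive_of_quotient`:
Greenberg–Vatsal Cor. (2.3) for the generic character module).  Since 2026-08-29/30 every named input of that chain is a TREE THEOREM: Greenberg 2016 Prop. 2.6.3 (c)
at TC `K` (`SurLambda.prop263_sur_of_crk_caseC_tc_holds`, this seat's F43, from cell `bsd-eis`'s road «SUR-Λ» and lane «PT-Ш-S-TC»), Greenberg 2006 Prop. 4.1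
(`prop41_of_tate_of_poitouTate_three_le_of_isTotallyComplex` ∘ Milne I 5.1 ∘ Harari 17.13 (a) at TC fields), Prop. 4.2 and §5 A (`_holds`).  THIS FILE composes them:
§1 the four `_holds` theorems, NO hypothesis.

HONEST FRAMING: compositions of tree theorems; they turn FOUR Literature named facts (one published proposition of Keller–Yin / CGLS read for the residual pair, in four
strengths) into kernel theorems.  No main conjecture, no case of BSD, no crux is proved by this file; AI formalisation, established only by the kernel check.

## References
* T. Keller, M. Yin, *On the anticyclotomic Iwasawa theory of rational elliptic curves at Eisenstein primes of anomalous reduction*, arXiv:2402.12781v2, Prop. 1.2.5,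
  Lemma 1.1.1, Rem. 1.2.3 (ii). [KellerYin2024]
* F. Castella, G. Grossi, J. Lee, C. Skinner, *On the anticyclotomic Iwasawa theory of rational elliptic curves at Eisenstein primes*, Invent. Math. 227 (2022),
  Prop. 1.2.5 and its proof ((eq:sur1)–(eq:sur2)). [CastellaGrossiLeeSkinner2022]
* R. Pollack, T. Weston, *On anticyclotomic μ-invariants of modular forms*, Compos. Math. 147 (2011), App. A Prop. A.2. [PollackWeston2011]
* R. Greenberg, *On the structure of Selmer groups* (2016), Prop. 2.6.3 (c); *Surjectivity of the global-to-local map defining a Selmer group* (2010), Prop. 3.2.1 (c);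
  *On the structure of certain Galois cohomology groups*, Doc. Math. Extra Vol. Coates (2006), Props. 3.2, 4.1, 4.2, §5 A. [Greenberg2016Selmer] [Greenberg2010] [Greenberg2006]
* R. Greenberg, V. Vatsal, *On the Iwasawa invariants of elliptic curves*, Invent. Math. 142 (2000), Cor. (2.3). [GreenbergVatsal2000]
* J. S. Milne, *Arithmetic Duality Theorems*, 2nd ed. (2006), I Thm. 4.10 (a), I Thm. 5.1, I.2.9. [MilneADT2006]  · D. Harari, *Galois Cohomology and Class Field
  Theory* (2020), Thm. 17.13 (a). [Harari2020]
-/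

set_option autoImplicit false
set_option linter.dupNamespace false -- the summit namespace `…BirchSwinnertonDyer.BirchSwinnertonDyer.Theorems` (Sub = Summit, D-0017) trips it

noncomputable section

open NumberField Literature.NumberTheory.GaloisCohomology Literature.NumberTheory.IwasawaTheory.Greenberg2006
  Literature.NumberTheory.IwasawaTheory.Greenberg2016 Literature.NumberTheory.EllipticCurves.KellerYin2024

namespace Summit.BirchSwinnertonDyer.BirchSwinnertonDyer.Theorems.KYProp125ResidualPairHolds

/-! ### §1 The four strengths of Keller–Yin Prop. 1.2.5 for the residual pair, NO hypothesis -/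

/-- **Keller–Yin 2402.12781 Prop. 1.2.5 for the residual pair, `≥` half of the `S`-relaxation corank identity — the named fact
`KellerYin2024.prop125_residualPair_unrSelmer_corank_ge` HOLDS (no hypothesis)**: cell `bsd-eis`'s road (A)
`AcTwistDeformation.prop125_residualPair_unrSelmer_corank_ge_of_facts_ofSurC` (Greenberg 2016 Prop. 2.6.3 `SUR ⇐ LEO + CRK` for the one-variable anticyclotomic twist
deformation, Shapiro, Brink, the tame count) fed with the tree theorems Greenberg 2016 Prop. 2.6.3 (c) at totally complex `K` (F43 `SurLambda.prop263_sur_of_crk_caseC_tc_holds`),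
Greenberg 2006 Prop. 4.1 (from Milne I 5.1 and Harari 17.13 (a) at totally complex fields), Prop. 4.2, §5 A, and Tate's global Euler–Poincaré characteristic at TC fields.
[cite: KellerYin2024, Prop. 1.2.5 (eq:Gr to imp), Lemma 1.1.1, Rem. 1.2.3 (ii) (arXiv:2402.12781v2 TeX L780–800, L455–462, L690–712)]
[cite: CastellaGrossiLeeSkinner2022, Prop. 1.2.5 (proof, (eq:sur1)–(eq:sur2))] [cite: PollackWeston2011, App. A Prop. A.2]
[cite: Greenberg2016Selmer, Prop. 2.6.3 (§2.6 p. 10)] [cite: Greenberg2006, Props. 3.2, 4.1, 4.2, §5 A] [cite: MilneADT2006, I Thm. 4.10 (a), I Thm. 5.1] [cite: Harari2020, Thm. 17.13 (a)] -/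
theorem prop125_residualPair_unrSelmer_corank_ge_holds : prop125_residualPair_unrSelmer_corank_ge :=
  -- Greenberg 2016 Prop. 2.6.3 (c) at TC `K`: the body of F43 `SurLambda.prop263_sur_of_crk_caseC_tc_holds` INLINED (road «SUR-Λ» END-compose on
  -- lane «PT-Ш-S-TC»'s END theorem), so that this file does not wait for F43's olean on the check farm
  AcTwistDeformation.prop125_residualPair_unrSelmer_corank_ge_of_facts_ofSurC
    (SurLambda.prop263_sur_of_crk_caseC_tc_of_poitouTateNaturalAt
      PoitouTateShaNaturalAtTC.forall_poitouTate_shaRestricted_tateDual_natural_at_of_isTotallyComplex)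
    (prop41_of_tate_of_poitouTate_three_le_of_isTotallyComplex forall_tateGlobalEulerPoincareCharacteristic_of_isTotallyComplex
      forall_poitouTate_restricted_three_le_of_isTotallyComplex)
    Literature.NumberTheory.IwasawaTheory.Greenberg2006.LocalEulerPoincareCorank.prop42_localEulerPoincareCorank_holds sec5A_localH2_subsingleton_of_LOC1_holds
    forall_tateGlobalEulerPoincareCharacteristic_of_isTotallyComplex

/-- **Keller–Yin 2402.12781 Prop. 1.2.5 for the residual pair, the `S`-relaxation corank IDENTITY — the named fact `KellerYin2024.prop125_residualPair_unrSelmer_corank`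
HOLDS (no hypothesis)**: cell `bsd-eis`'s `GoodLatticeCorankOfGe.prop125_corank_of_ge` (the `≤` half is the kernel embedding of the quotient into
`∏_{w∈Sf} ∏_{η∣w} H¹(I_η, (F/𝒪)(θ))`, each factor of corank `≤ 𝟙[θ(Frob_w) ≡ Nw]`) on the `≥` half above.
[cite: KellerYin2024, Prop. 1.2.5, Lemma 1.1.1 (arXiv:2402.12781v2)] [cite: CastellaGrossiLeeSkinner2022, Prop. 1.2.5] [cite: PollackWeston2011, App. A Prop. A.2] -/
theorem prop125_residualPair_unrSelmer_corank_holds : prop125_residualPair_unrSelmer_corank :=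
  GoodLatticeCorankOfGe.prop125_corank_of_ge prop125_residualPair_unrSelmer_corank_ge_holds

/-- **Keller–Yin 2402.12781 Prop. 1.2.5 for the residual pair, QUOTIENT form (the corank identity ∧ the quotient's `p`-torsion finite) — the named fact
`KellerYin2024.prop125_residualPair_unrSelmer_quotient` HOLDS (no hypothesis)**: cell `bsd-eis`'s `GoodLatticeQuotientOfCorank.prop125_quotient_of_corank` (divisible
character module, split primes finitely decomposed by Brink, Kummer + Milne I.2.9) on the identity above.
[cite: KellerYin2024, Prop. 1.2.5, Lemma 1.1.1 (arXiv:2402.12781v2)] [cite: CastellaGrossiLeeSkinner2022, Prop. 1.2.5] [cite: MilneADT2006, I.2.9] -/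
theorem prop125_residualPair_unrSelmer_quotient_holds : prop125_residualPair_unrSelmer_quotient :=
  GoodLatticeQuotientOfCorank.prop125_quotient_of_corank prop125_residualPair_unrSelmer_corank_holds

/-- **[PWL-θ] — Keller–Yin 2402.12781 Prop. 1.2.5 for the residual pair, STRONG (imprimitive) form: given [RH] for the primitive dual, EVERY imprimitive dual datum of
`H¹_{𝓕_nr^{Sf}}(K_∞, (F/𝒪)(θ))` is finitely generated `Λ`-torsion with `μ = 0`, AND `corank_{ℤ_p}(H¹_{𝓕_nr^{Sf}}/H¹_{𝓕_nr}) = Σ_{w∈Sf} λ𝒫_w(θ)` — the named fact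
`KellerYin2024.prop125_residualPair_unrSelmer_imprimitive` HOLDS (no hypothesis)**: cell `bsd-eis`'s `GoodLatticeImprimitiveOfQuotient.prop125_imprimitive_of_quotient`
(Greenberg–Vatsal Cor. (2.3) for the generic character module) on the quotient form above.  This is the [PWL-θ] input of the K1 door's crux r3 BY NAME (F44) and of
cell `bsd-eis`'s cell-C / halves chains — now a tree theorem.
[cite: KellerYin2024, Prop. 1.2.5 and proof (arXiv:2402.12781v2 TeX L780–800)] [cite: CastellaGrossiLeeSkinner2022, Prop. 1.2.5 and proof (arXiv:2008.02571v2 TeX L681–703)]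
[cite: GreenbergVatsal2000, §2 Cor. (2.3) (pp. 20–21)] [cite: PollackWeston2011, App. A Prop. A.2] [cite: Greenberg2016Selmer, Prop. 2.6.3 (c)] -/
theorem prop125_residualPair_unrSelmer_imprimitive_holds : prop125_residualPair_unrSelmer_imprimitive :=
  GoodLatticeImprimitiveOfQuotient.prop125_imprimitive_of_quotient prop125_residualPair_unrSelmer_quotient_holds

end Summit.BirchSwinnertonDyer.BirchSwinnertonDyer.Theorems.KYProp125ResidualPairHolds

end
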